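import Mathlib

/-!
# Contractions of variable ideals `⟨x_i : i ∈ Z⟩` along substitutions and renamings

(crux stmt-ResolutionOfSingularities-15640 `WildQuotients.WildQuotientResolution`, line `Sketch`;
chain w45c RUNG V5, brick `HP₀` ring side `JordanFive.exists_ringBrick_X0_model` (res-L1-w45c-plan-1
ORDERS 2026-08-27T12:39:07Z; prover res-L1-w45c-stub-2): the two radical identities of the `μ₄` ring
model contract the prime `⟨x_a, x_b, x_d⟩` (edge surface) resp. `⟨x_a, x_b, x_c, x_d⟩` (vertex curve)
of the root chart through res-type-036's slot substitution `θ` (`x_b ↦ N`, `x_c ↦ γ₂″`, `x_d ↦ γ₃″`,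
`x_e ↦ γ₄″`) and through the renaming of the cone symbols. [OURS · L1 W4.5c] — generic commutative
algebra, NOT a statement of any manuscript. Def-free.)

For a set of variables `Z ⊆ σ` write `M_Z = ⟨X i : i ∈ Z⟩ ⊆ R[x_σ]` and `κ_Z` for the substitution
`x_i ↦ 0 (i ∈ Z)`, `x_i ↦ x_i (i ∉ Z)` (spelt out as an `aeval`, no definition is introduced).

* `sub_aeval_kill_mem_span_X` — `f − κ_Z f ∈ M_Z`;
* `ker_aeval_kill_eq_span_X` — `ker κ_Z = M_Z`;
* `comap_span_X_eq_of_kill_comp` — **`θ⁻¹(M_Z) = M_Z`** for an algebra endomorphism `θ` such that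
  `κ_Z ∘ θ = τ ∘ κ_Z` on the variables for some INJECTIVE endomorphism `τ`;
* `comap_rename_span_X` — `(rename f)⁻¹ ⟨X i : i ∈ T⟩ = ⟨X j : f j ∈ T⟩` for injective `f`.
-/

-- single-problem summit: the doubled namespace component `ResolutionOfSingularities` is forced
set_option linter.dupNamespace false

noncomputable section

open MvPolynomial

namespace Summit.ResolutionOfSingularities.ResolutionOfSingularities.Theorems.WildQuotientResolution.SpanX

variable {σ R : Type*} [CommRing R] (Z : Set σ) [DecidablePred (· ∈ Z)]

/-- `f − κ_Z f ∈ ⟨X i : i ∈ Z⟩` for the substitution `κ_Z` killing the variables of `Z`. [folklore] -/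
theorem sub_aeval_kill_mem_span_X (f : MvPolynomial σ R) :
    f - aeval (fun i => if i ∈ Z then (0 : MvPolynomial σ R) else X i) f ∈
      Ideal.span (X '' Z : Set (MvPolynomial σ R)) := by
  induction f using MvPolynomial.induction_on with
  | C r => simp
  | add p q hp hq =>
    have e : p + q - aeval (fun i => if i ∈ Z then (0 : MvPolynomial σ R) else X i) (p + q) =
        (p - aeval (fun i => if i ∈ Z then (0 : MvPolynomial σ R) else X i) p) +
        (q - aeval (fun i => if i ∈ Z then (0 : MvPolynomial σ R) else X i) q) := by
      rw [map_add]; ring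
    rw [e]
    exact Ideal.add_mem _ hp hq
  | mul_X p i hp =>
    rw [map_mul, aeval_X]
    by_cases hi : i ∈ Z
    · rw [if_pos hi, mul_zero, sub_zero]
      exact Ideal.mul_mem_left _ _ (Ideal.subset_span ⟨i, hi, rfl⟩)
    · rw [if_neg hi, ← sub_mul]
      exact Ideal.mul_mem_right _ _ hp

/-- **`ker κ_Z = ⟨X i : i ∈ Z⟩`.** [folklore] -/
theorem ker_aeval_kill_eq_span_X :
    RingHom.ker (aeval (fun i => if i ∈ Z then (0 : MvPolynomial σ R) else X i)).toRingHom =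
      Ideal.span (X '' Z : Set (MvPolynomial σ R)) := by
  apply le_antisymm
  · intro f hf
    rw [RingHom.mem_ker] at hf
    have h := sub_aeval_kill_mem_span_X Z f
    have hf' : aeval (fun i => if i ∈ Z then (0 : MvPolynomial σ R) else X i) f = 0 := hf
    rwa [hf', sub_zero] at h
  · rw [Ideal.span_le]
    rintro _ ⟨i, hi, rfl⟩
    change aeval (fun i => if i ∈ Z then (0 : MvPolynomial σ R) else X i) (X i) = 0
    rw [aeval_X, if_pos hi]

/-- **`θ⁻¹ ⟨X i : i ∈ Z⟩ = ⟨X i : i ∈ Z⟩`** for an `R`-algebra endomorphism `θ` of `R[x_σ]` such that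
`κ_Z (θ xᵢ) = τ (κ_Z xᵢ)` for all `i`, for some injective endomorphism `τ` (`κ_Z` = kill the variables of
`Z`): then `κ_Z ∘ θ = τ ∘ κ_Z`, so `ker (κ_Z ∘ θ) = ker κ_Z`. [folklore] -/
theorem comap_span_X_eq_of_kill_comp (θ τ : MvPolynomial σ R →ₐ[R] MvPolynomial σ R)
    (hτ : Function.Injective τ)
    (h : ∀ i, aeval (fun i => if i ∈ Z then (0 : MvPolynomial σ R) else X i) (θ (X i)) =
      τ (aeval (fun i => if i ∈ Z then (0 : MvPolynomial σ R) else X i) (X i : MvPolynomial σ R))) :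
    (Ideal.span (X '' Z : Set (MvPolynomial σ R))).comap θ = Ideal.span (X '' Z) := by
  have hcomp : (aeval (fun i => if i ∈ Z then (0 : MvPolynomial σ R) else X i)).comp θ =
      τ.comp (aeval (fun i => if i ∈ Z then (0 : MvPolynomial σ R) else X i)) :=
    MvPolynomial.algHom_ext fun i => by simpa only [AlgHom.comp_apply] using h i
  have h1 : (Ideal.span (X '' Z : Set (MvPolynomial σ R))).comap θ =
      RingHom.ker ((aeval (fun i => if i ∈ Z then (0 : MvPolynomial σ R) else X i)).comp θ).toRingHom := by
    rw [← ker_aeval_kill_eq_span_X Z]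
    exact (RingHom.comap_ker _ _)
  rw [h1, hcomp]
  change RingHom.ker ((τ : MvPolynomial σ R →+* MvPolynomial σ R).comp
    (aeval (fun i => if i ∈ Z then (0 : MvPolynomial σ R) else X i)).toRingHom) = _
  have hker : RingHom.ker (τ : MvPolynomial σ R →+* MvPolynomial σ R) = ⊥ :=
    (RingHom.injective_iff_ker_eq_bot _).mp hτ
  rw [← RingHom.comap_ker, hker, ← RingHom.ker_eq_comap_bot, ker_aeval_kill_eq_span_X]

omit [DecidablePred (· ∈ Z)] in
/-- **`(rename f)⁻¹ ⟨X i : i ∈ T⟩ = ⟨X j : f j ∈ T⟩`** for an injective renaming `f : σ → τ`.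
[folklore] -/
theorem comap_rename_span_X {τ : Type*} (f : σ → τ) (hf : Function.Injective f) (T : Set τ) :
    (Ideal.span (X '' T : Set (MvPolynomial τ R))).comap
        (rename f : MvPolynomial σ R →ₐ[R] MvPolynomial τ R) =
      Ideal.span (X '' (f ⁻¹' T) : Set (MvPolynomial σ R)) := by
  classical
  ext g
  rw [Ideal.mem_comap, MvPolynomial.mem_ideal_span_X_image, MvPolynomial.mem_ideal_span_X_image]
  change (∀ m ∈ (rename f g).support, ∃ i ∈ T, m i ≠ 0) ↔ _
  rw [MvPolynomial.support_rename_of_injective hf]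
  constructor
  · intro H m hm
    obtain ⟨i, hiT, hi⟩ := H (Finsupp.mapDomain f m) (Finset.mem_image_of_mem _ hm)
    by_cases hir : i ∈ Set.range f
    · obtain ⟨j, rfl⟩ := hir
      rw [Finsupp.mapDomain_apply hf] at hi
      exact ⟨j, hiT, hi⟩
    · exact absurd (Finsupp.mapDomain_notin_range m i hir) hi
  · intro H m' hm'
    obtain ⟨m, hm, rfl⟩ := Finset.mem_image.mp hm'
    obtain ⟨j, hjT, hj⟩ := H m hm
    exact ⟨f j, hjT, by rwa [Finsupp.mapDomain_apply hf]⟩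

end Summit.ResolutionOfSingularities.ResolutionOfSingularities.Theorems.WildQuotientResolution.SpanX

end
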